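import Summits.ResolutionOfSingularities.ResolutionOfSingularities.Theorems.WildLogDiagonalLU
import HarnessLib

/-!
# WildLogDiagonalLU2 — PART A2: NAKAYAMA generation of the augmentation ideal at a centre with fixed residues, the `p`-LUCKY clause `Lucky p N a′` (decidable), LUCKY ⇒ one twist divides all

One of the five landing files of the g32 node «LogDiagonalCut» of the ROOT/RESIDUAL decomposition cell `decomp-res`
(lens 1; door (W-wild-PROD) of NEXT-g32, critic letters 229a / 229b, ROW 234; files `WildLogDiagonalLU`, `…LU2`,
`…LU3`, `…LU4`, `…LU5`); see the module docstring of `Summits.ResolutionOfSingularities.ResolutionOfSingularities.Theorems.WildLogDiagonalLU`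
for the thesis (the binomial log-diagonal wild `ℤ/p` cell decided hypothesis-free by PRODUCTION of the pseudo-reflection
model — toric chart + Frobenius normal form + Nakayama + derivation rule — then the g31 law / [KiralyLutkebohmert2013,
Thm. 2] BY NAME), the cell `WildLogDiagonalLUAbove k O` and the law `relLU_of_wildLogDiagonalLUAbove` (in `…LU4`), the
toy census, the instances, the control certificate and the typed complement kinds, the honest scope and the sources.
This file: `exists_apply_sub_eq_sum` (Nakayama), `Lucky` + `lucky_iff_exists`, `exists_twist_eq_mul_of_lucky`.
Imports: the slice `…WildLogDiagonalLU` (PART A1: Frobenius normal form, derivation rule).  Problem side, sorry-free, hypothesis-free (zero fact binders); every heavy theorem carries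
`set_option maxHeartbeats … in` BEFORE its docstring — keep it.
-/

noncomputable section

open Literature.AlgebraicGeometry.Resolution
open Summit.ResolutionOfSingularities.ResolutionOfSingularities.Theorems.InertDescentLU
open Summit.ResolutionOfSingularities.ResolutionOfSingularities.Theorems.InvariantDescentLU
open Summit.ResolutionOfSingularities.ResolutionOfSingularities.Theorems.WildReflectionLU

universe u

namespace Summit.ResolutionOfSingularities.ResolutionOfSingularities.Theorems.WildLogDiagonalLU

variable {E : Type u} [Field E]

/-! ### Nakayama: the augmentation ideal at a centre with fixed residues is generated by the twists of an r.s.p. -/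

section Nakayama

open IsLocalRing

variable (O : ValuationSubring E) {T : Subring E} {σ : E ≃+* E}

set_option maxHeartbeats 400000 in
/-- **NAKAYAMA GENERATION OF THE AUGMENTATION IDEAL.**  Let `B = T_𝔪′` be the (Noetherian) local ring of a model
`T ⊆ O` at the centre of `O`, stable under an automorphism `σ` preserving `O`, such that every `b ∈ B` is congruent
modulo the centre to a `σ`-FIXED element of `B` (residues rational and fixed), and let `x₁, …, x_d ∈ 𝔪_B` generate
the centre `𝔪_B`.  Then `σ b − b ∈ (σ x₁ − x₁, …, σ x_d − x_d)·B` for every `b ∈ B`: writing `b = c + Σ bᵢ xᵢ`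
gives `I(b) = Σ (I(bᵢ)·σxᵢ + bᵢ·I(xᵢ)) ∈ 𝔪_B·I_G + (I(xᵢ))ᵢ`, and Nakayama
(`Submodule.le_of_le_smul_of_le_jacobson_bot`) concludes.
[cite: KiralyLutkebohmert2013, p. 64, «I_G is generated by σ(y) − y, y a system of parameters»]
[cite: LorenziniSchroer2019, Section 6, p. 23] -/
theorem exists_apply_sub_eq_sum (hTO : T ≤ O.toSubring) (hσO : ∀ z : E, z ∈ O ↔ σ z ∈ O)
    (hσT : ∀ z ∈ T, σ z ∈ T) [IsNoetherianRing (locAtCentre T O)]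
    (hres : ∀ b ∈ locAtCentre T O, ∃ c ∈ locAtCentre T O, σ c = c ∧ O.valuation (b - c) < 1)
    {d : ℕ} {x : Fin d → E} (hx : ∀ i, x i ∈ locAtCentre T O ∧ O.valuation (x i) < 1)
    (hgen : ∀ b ∈ locAtCentre T O, O.valuation b < 1 →
      ∃ c : Fin d → E, (∀ i, c i ∈ locAtCentre T O) ∧ b = ∑ i, c i * x i)
    {b : E} (hb : b ∈ locAtCentre T O) :
    ∃ c : Fin d → E, (∀ i, c i ∈ locAtCentre T O) ∧ σ b - b = ∑ i, c i * (σ (x i) - x i) := by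
  classical
  set B : Subring E := locAtCentre T O with hBdef
  haveI : IsLocalRing B := isLocalRing_locAtCentre hTO
  have hσB : ∀ z ∈ B, σ z ∈ B := fun z hz => apply_mem_locAtCentre O hσO hσT hz
  have hmem : ∀ z : B, z ∈ maximalIdeal B ↔ O.valuation (z : E) < 1 := mem_maximalIdeal_locAtCentre_iff hTO
  -- the augmentation map and the two ideals
  let f : B → B := fun z => ⟨σ z - z, B.sub_mem (hσB z z.2) z.2⟩
  let J : Ideal B := Ideal.span (Set.range f)
  let gx : Fin d → B := fun i => ⟨σ (x i) - x i, B.sub_mem (hσB _ (hx i).1) (hx i).1⟩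
  let X : Ideal B := Ideal.span (Set.range gx)
  have hJfg : J.FG := IsNoetherian.noetherian J
  -- `J ≤ X + 𝔪 J`
  have hle : J ≤ X ⊔ maximalIdeal B • J := by
    refine Ideal.span_le.mpr ?_
    rintro _ ⟨b', rfl⟩
    obtain ⟨c, hcB, hσc, hvc⟩ := hres b' b'.2
    obtain ⟨cf, hcf, hsum⟩ := hgen (b' - c) (B.sub_mem b'.2 hcB) hvc
    have hcoe : ∀ g : Fin d → B, (((∑ i, g i : B)) : E) = ∑ i, (g i : E) := fun g =>
      map_sum B.subtype g Finset.univ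
    have key : f b' = ∑ i, ((⟨σ (x i), hσB _ (hx i).1⟩ : B) * f ⟨cf i, hcf i⟩ + ⟨cf i, hcf i⟩ * gx i) := by
      apply Subtype.ext
      rw [hcoe]
      simp only [f, gx, Subring.coe_add, Subring.coe_mul]
      have e1 : σ (b' : E) - b' = σ ((b' : E) - c) - ((b' : E) - c) := by rw [map_sub, hσc]; ring
      rw [e1, hsum, map_sum, ← Finset.sum_sub_distrib]
      refine Finset.sum_congr rfl fun i _ => ?_
      rw [map_mul]
      ring
    change f b' ∈ X ⊔ maximalIdeal B • J
    rw [key]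
    refine Submodule.sum_mem _ fun i _ => Submodule.add_mem _ ?_ ?_
    · refine Submodule.mem_sup_right (Submodule.smul_mem_smul ?_ (Ideal.subset_span ⟨_, rfl⟩))
      exact (hmem _).mpr (valuation_apply_lt_one O hσO (hx i).2)
    · exact Submodule.mem_sup_left (Ideal.mul_mem_left X _ (Ideal.subset_span ⟨i, rfl⟩))
  have hJX : J ≤ X :=
    Submodule.le_of_le_smul_of_le_jacobson_bot hJfg (maximalIdeal_le_jacobson ⊥) hle
  have hbX : f ⟨b, hb⟩ ∈ X := hJX (Ideal.subset_span ⟨⟨b, hb⟩, rfl⟩)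
  obtain ⟨cf, hcf⟩ := (Submodule.mem_span_range_iff_exists_fun B).mp hbX
  refine ⟨fun i => (cf i : E), fun i => (cf i).2, ?_⟩
  have hcoe : ∀ g : Fin d → B, (((∑ i, g i : B)) : E) = ∑ i, (g i : E) := fun g =>
    map_sum B.subtype g Finset.univ
  have h := congrArg Subtype.val hcf
  simp only [smul_eq_mul] at h
  rw [hcoe] at h
  simp only [f, gx, Subring.coe_mul] at h
  exact h.symm

end Nakayama

/-! ### The `p`-LUCKY arithmetic clause and the divisibility it produces -/

section Lucky

/-- **The `p`-LUCKY clause** (tag DATA · the decidable ARITHMETIC clause (L) of the cell; no ring in sight) on a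
twist vector `N : Fin d → ℤ`, pivot exponents `a′ : Fin d → ℕ` and the prime `p`: the `p`-adic valuation of `N`
is attained at EXACTLY ONE coordinate `j₀`
(`N_{j₀} = p^{e₀}·m₀`, `p ∤ m₀`, `p^{e₀+1} ∣ N_j` for `j ≠ j₀`) and, as soon as some other coordinate moves at all,
the pivot monomial passes through `x′_{j₀}` (`a′_{j₀} ≥ 1`).  In the rank-2 monomial family of the g31 registry
(twists `±(b₁, −b₂)` by consecutive continuants) it reads `v_p(b₁) ≠ v_p(b₂)`, i.e. `p ∣ b₁ b₂`.  TYPED IN THE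
MANIFESTLY DECIDABLE FORM (`e₀ ≤ |N_{j₀}|`, `m₀ := N_{j₀} / p^{e₀}`; `unfold Lucky; decide` evaluates it, and
`unfold Lucky; infer_instance` synthesises `Decidable (Lucky p N a′)`) — equivalent to the free form by
`lucky_iff_exists`. [cite: KiralyLutkebohmert2013, Ex. 6, p. 66] -/
def Lucky (p : ℕ) {d : ℕ} (N : Fin d → ℤ) (a' : Fin d → ℕ) : Prop :=
  ∃ j₀ : Fin d, ∃ e₀ : ℕ, e₀ < (N j₀).natAbs + 1 ∧ ¬ ((p : ℤ) ∣ N j₀ / (p : ℤ) ^ e₀) ∧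
    N j₀ = (p : ℤ) ^ e₀ * (N j₀ / (p : ℤ) ^ e₀) ∧
    ∀ j : Fin d, j ≠ j₀ → (p : ℤ) ^ (e₀ + 1) ∣ N j ∧ (N j ≠ 0 → 1 ≤ a' j₀)

/-- `Lucky` in its free form `∃ j₀ e₀ m₀, p ∤ m₀ ∧ N_{j₀} = p^{e₀} m₀ ∧ ∀ j ≠ j₀, p^{e₀+1} ∣ N_j ∧ (N_j ≠ 0 → 1 ≤ a′_{j₀})`
(the bound `e₀ ≤ |N_{j₀}|` and `m₀ = N_{j₀} / p^{e₀}` are forced). [folklore] -/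
theorem lucky_iff_exists {p : ℕ} (hp : p.Prime) {d : ℕ} (N : Fin d → ℤ) (a' : Fin d → ℕ) :
    Lucky p N a' ↔ ∃ j₀ : Fin d, ∃ e₀ : ℕ, ∃ m₀ : ℤ, ¬ ((p : ℤ) ∣ m₀) ∧ N j₀ = (p : ℤ) ^ e₀ * m₀ ∧
      ∀ j : Fin d, j ≠ j₀ → (p : ℤ) ^ (e₀ + 1) ∣ N j ∧ (N j ≠ 0 → 1 ≤ a' j₀) := by
  refine ⟨fun ⟨j₀, e₀, _, hm, hN, hr⟩ => ⟨j₀, e₀, _, hm, hN, hr⟩, fun ⟨j₀, e₀, m₀, hm, hN, hr⟩ => ?_⟩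
  have hp0 : (p : ℤ) ^ e₀ ≠ 0 := pow_ne_zero _ (by exact_mod_cast hp.ne_zero)
  have hdiv : N j₀ / (p : ℤ) ^ e₀ = m₀ := by rw [hN, Int.mul_ediv_cancel_left _ hp0]
  have hm0 : m₀ ≠ 0 := by rintro rfl; exact hm (dvd_zero _)
  refine ⟨j₀, e₀, ?_, by rwa [hdiv], by rw [hdiv]; exact hN, hr⟩
  have h1 : ((p : ℤ) ^ e₀).natAbs ≤ (N j₀).natAbs :=
    Int.natAbs_le_of_dvd_ne_zero ⟨m₀, hN⟩ (by rw [hN]; exact mul_ne_zero hp0 hm0)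
  have h2 : e₀ < ((p : ℤ) ^ e₀).natAbs := by
    rw [Int.natAbs_pow, Int.natAbs_natCast]
    exact Nat.lt_pow_self hp.one_lt
  omega

variable (O : ValuationSubring E) {T : Subring E}

set_option maxHeartbeats 400000 in
/-- **LUCKY ⇒ ONE TWIST DIVIDES ALL.**  In the local ring `B′ = T_𝔪′ ⊆ O` (characteristic `p`) let
`x′₁, …, x′_d ∈ B′` be non-zero, `η = w·∏ x′_j^{a′_j}` with `w` a unit and `v(η) < 1`, `(1 + η)⁻¹ ∈ B′`, and let the
twists be `N`.  If `(N, a′)` is `p`-lucky with lucky index `j₀`, then the augmentation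
`δ := x′_{j₀}·((1 + η)^{N_{j₀}} − 1)` is NON-ZERO and DIVIDES every `x′_j·((1 + η)^{N_j} − 1)` in `B′`:
by the Frobenius normal form the quotient is `c₀⁻¹ c_j · x′_j · η^{p^{e₀+1} − p^{e₀}} / x′_{j₀}`, which lies in
`B′` because the pivot passes through `x′_{j₀}`. [cite: KiralyLutkebohmert2013, Ex. 6, p. 66] -/
theorem exists_twist_eq_mul_of_lucky (p : ℕ) [hp : Fact p.Prime] [CharP E p] (hTO : T ≤ O.toSubring)
    {d : ℕ} {x' : Fin d → E} (hx' : ∀ j, x' j ∈ locAtCentre T O ∧ x' j ≠ 0)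
    {η w : E} (hw : w ∈ locAtCentre T O ∧ O.valuation w = 1) (hηv : O.valuation η < 1)
    {a' : Fin d → ℕ} (hη : η = w * ∏ j, x' j ^ a' j) (hinv : (1 + η)⁻¹ ∈ locAtCentre T O)
    {N : Fin d → ℤ} (hL : Lucky p N a') :
    ∃ j₀ : Fin d, x' j₀ * ((1 + η) ^ N j₀ - 1) ≠ 0 ∧
      ∀ j : Fin d, ∃ c ∈ locAtCentre T O,
        x' j * ((1 + η) ^ N j - 1) = x' j₀ * ((1 + η) ^ N j₀ - 1) * c := by
  classical
  set B : Subring E := locAtCentre T O with hBdef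
  have hBO : B ≤ O.toSubring := locAtCentre_le hTO
  obtain ⟨j₀, e₀, m₀, hm₀, hN₀, hrest⟩ := (lucky_iff_exists hp.out N a').1 hL
  have hηB : η ∈ B := by
    rw [hη]
    exact B.mul_mem hw.1 (B.prod_mem fun j _ => B.pow_mem (hx' j).1 _)
  have hprod0 : ∏ j, x' j ^ a' j ≠ 0 := Finset.prod_ne_zero_iff.mpr fun j _ => pow_ne_zero _ (hx' j).2
  have hw0 : w ≠ 0 := ne_zero_of_valuation_eq_one hw.2
  have hη0 : η ≠ 0 := by rw [hη]; exact mul_ne_zero hw0 hprod0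
  -- the lucky coordinate: `(1 + η)^{N j₀} − 1 = η^{p^{e₀}} c₀`, `c₀` a unit
  obtain ⟨c₀, hc₀B, hc₀v, hc₀⟩ := exists_one_add_zpow_sub_one_eq O p B hBO hηB hηv hinv e₀ hm₀
  have hc₀0 : c₀ ≠ 0 := ne_zero_of_valuation_eq_one hc₀v
  have hc₀inv : c₀⁻¹ ∈ B := inv_mem_locAtCentre hc₀B hc₀v
  refine ⟨j₀, ?_, fun j => ?_⟩
  · rw [hN₀, hc₀]
    exact mul_ne_zero (hx' j₀).2 (mul_ne_zero (pow_ne_zero _ hη0) hc₀0)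
  by_cases hj : j = j₀
  · subst hj
    exact ⟨1, B.one_mem, (mul_one _).symm⟩
  obtain ⟨hdvd, ha'⟩ := hrest j hj
  by_cases hNj : N j = 0
  · exact ⟨0, B.zero_mem, by rw [hNj, zpow_zero, sub_self, mul_zero, mul_zero]⟩
  have ha : 1 ≤ a' j₀ := ha' hNj
  obtain ⟨m', hm'⟩ := hdvd
  obtain ⟨cj, hcjB, hcj⟩ := exists_one_add_zpow_sub_one_eq' O p B hBO hηB hηv hinv (e₀ + 1) m'
  -- `η = x′_{j₀} · r₁` with `r₁ ∈ B` (the pivot passes through `x′_{j₀}`)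
  obtain ⟨n, hn⟩ : ∃ n, a' j₀ = n + 1 := ⟨a' j₀ - 1, by omega⟩
  set r₁ : E := w * (x' j₀ ^ n * ∏ i ∈ Finset.univ.erase j₀, x' i ^ a' i) with hr₁
  have hr₁B : r₁ ∈ B := B.mul_mem hw.1 (B.mul_mem (B.pow_mem (hx' j₀).1 _)
    (B.prod_mem fun i _ => B.pow_mem (hx' i).1 _))
  have hηr : η = x' j₀ * r₁ := by
    rw [hη, hr₁, ← Finset.mul_prod_erase Finset.univ (fun i => x' i ^ a' i) (Finset.mem_univ j₀), hn,
      pow_succ]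
    ring
  -- exponent bookkeeping: `p^{e₀+1} = p^{e₀} + M`, `M = M′ + 1`
  obtain ⟨M', hM'⟩ : ∃ M', p ^ (e₀ + 1) = p ^ e₀ + (M' + 1) := by
    have h1 : p ^ e₀ < p ^ (e₀ + 1) := Nat.pow_lt_pow_right hp.out.one_lt (lt_add_one e₀)
    exact ⟨p ^ (e₀ + 1) - p ^ e₀ - 1, by omega⟩
  refine ⟨c₀⁻¹ * cj * r₁ * η ^ M' * x' j, B.mul_mem (B.mul_mem (B.mul_mem (B.mul_mem hc₀inv hcjB) hr₁B)
    (B.pow_mem hηB _)) (hx' j).1, ?_⟩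
  have hcc : c₀ * c₀⁻¹ = 1 := mul_inv_cancel₀ hc₀0
  rw [hm', hcj, hN₀, hc₀, hM', pow_add, pow_succ]
  linear_combination (x' j * η ^ p ^ e₀ * η ^ M' * cj) * hηr
    + (-(x' j * η ^ p ^ e₀ * η ^ M' * cj * x' j₀ * r₁)) * hcc

end Lucky

end Summit.ResolutionOfSingularities.ResolutionOfSingularities.Theorems.WildLogDiagonalLU

end
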